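import Mathlib
import HarnessLib
import Summits.HubbardSuperconductivity.HubbardSuperconductivity.Theorems.KLProgrammeForwardBubbleRay
import Summits.HubbardSuperconductivity.HubbardSuperconductivity.Theorems.KLProgrammePolarRayCoareaJacobianFrame

/-!
# Route `KLProgramme` — crux K3, ENGINE child (stmt-HubbardSuperconductivity-19855 `KLRegimeEngineV12`): the FORWARD particle–hole slice bubble of the
# frame band `e = ε₀ + δ − μ` — PER-RAY and PLANAR bounds (zero-sound remainder + thermal layer + transfer shift) in ONE citation
# (cell gate-hubbard-kl, seat hubbard-kl-k3c2-p2 «thermal-bar induction n ≤ nScales β + 1»)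

Continuation of `…ForwardBubbleRay` (objects `klfb_band/prop/rayPt/jac/weight/shift`, the one-ray coarea `klfb_ray_integral_eq`, the window
hypotheses of the insertion `W_θ = 𝒥_E·A` and of the shift `σ_θ`).  Here: the planar forward-bubble integrand family
`h_i(p) = A(p)·Φ_f(ω_i, e(p))·Φ_{f'}(ω_i + q₀, e'(p))` (`klfb_integrand`), its continuity / support (§5), the per-ray identity
`∫_{t>0} t•h_i(t cos θ, t sin θ) dt = ∫ W_θ·Φ_f(ω_i,·)·Φ_{f'}(ω_i+q₀, · + σ_θ)` (`klfb_ray_bubble_integral_eq`), the PER-RAY bound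
`klfb_ray_bubble_norm_le` (= `klsw_slice_bubble_transfer_norm_le` with `B_W = A₀π√2/d`, `L_W = (π√2/d)A₁/d + A₀(1/d² + π√2(2+κ₂)/d³)`,
`d = Dt_min − κ₁`), and the PLANAR bound `klfb_planar_bubble_norm_le` (angle integration, `klry_norm_smul_sum_integral_le_of_ray_bound`):
`‖β⁻¹•Σ_i ∫d²p h_i‖ ≤ 2π·[(524288/π)(ℓ+8M_F)L_WΛ_n + (393216/π)(ℓ+8M_F)B_W(π/β)/Λ_n + (1024/π)M_f(48ℓ'+193M_f')B_W(|q₀|+δ_max)/Λ_n]` —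
the `C₀4^{−n}` branch, the THERMAL LAYER (`(π/β)/Λ_n ≤ 4·4^{−(n_β−n)}` = the `thermalBar` profile, `klte_ratio_le_four_mul_inv_pow`) and the
`K·ρ/Λ_n` branch of the «below-resolution» particle–hole gain, for the frame band, uniformly in the angle.  Both shell-weight pairs of the
Wick-ordered step's rung (p1 g8 E2-STRUCTURE-NOTE §4: `g⊗g`, and `g⊗D` with the soft partner after the window reduction) are instances of `(f, f')`.
Pure analysis on the tree's objects; nothing about the model is asserted.
References: BGM 2006 §2.5 (2.56b)–(2.56e), (2.38); HOME/p1/E2-NOTE.md §3; HOME/hubbard-kl-k3c2-p2/ZS-RECIPE.md §2–§4, ZS-RECIPE-v5.md §B.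
-/

noncomputable section

namespace Summit.HubbardSuperconductivity.HubbardSuperconductivity.Theorems.KLRegimeSplit

set_option linter.dupNamespace false -- summit = problem name (single-conjunct summit), D-0017

open Real Set Filter MeasureTheory intervalIntegral Complex Literature.MathematicalPhysics.QuantumLattice
open Literature.MathematicalPhysics.QuantumLattice.BandSectorCounting Literature.Probability.LatticeModels
open Summit.HubbardSuperconductivity.HubbardSuperconductivity.Theorems.PerturbedFermiCurve
open Summit.HubbardSuperconductivity.HubbardSuperconductivity.Theorems.KLProgrammeLegKernels
open Summit.HubbardSuperconductivity.HubbardSuperconductivity.Theorems.DispersionFlow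

section Frame

variable {a b : ℝ} (B : BandBounds a b) {δ : (Fin 2 → ℝ) → ℝ} (hδ1 : ContDiff ℝ 1 δ) {κ₀ κ₁ : ℝ}
  (hδ : ∀ k : Fin 2 → ℝ, (∀ i, |k i| ≤ π) → |δ k| ≤ κ₀)
  (hκ : ∀ k : Fin 2 → ℝ, (∀ i, |k i| ≤ π) → ‖fderiv ℝ δ k‖ ≤ κ₁) (hκ₁ : κ₁ < B.Dtmin)

/-! ## §5 The forward-bubble integrand family: per-ray identity and PER-RAY BOUND -/

omit B in
/-- **The planar forward-bubble integrand** at loop frequency `k₀` and transfer frequency `q₀`: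
`h(p) = A(p)·Φ_f(k₀, e(p))·Φ_{f'}(k₀ + q₀, e'(p))` (`e = klfb_band δ μ`, `e'` the shifted band). -/
def klfb_integrand (δ : (Fin 2 → ℝ) → ℝ) (μ : ℝ) (A : ℝ × ℝ → ℂ) (f f' : ℝ → ℂ) (e' : ℝ × ℝ → ℝ) (k₀ q₀ : ℝ) (p : ℝ × ℝ) : ℂ :=
  A p * klfb_prop f k₀ (klfb_band δ μ p) * klfb_prop f' (k₀ + q₀) (e' p)

omit B in
/-- The planar band `e = ε₀ + δ − μ` is continuous for continuous `δ`. -/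
theorem klfb_continuous_band (hδc : Continuous δ) (μ : ℝ) : Continuous (klfb_band δ μ) := by
  have hv : Continuous fun p : ℝ × ℝ => (![p.1, p.2] : Fin 2 → ℝ) := by
    refine continuous_pi fun i => ?_
    fin_cases i
    · simpa using continuous_fst
    · simpa using continuous_snd
  have hsq : Continuous sqDispersion := by unfold sqDispersion; fun_prop
  unfold klfb_band
  exact ((hsq.comp hv).add (hδc.comp hv)).sub continuous_const

omit B in
/-- **Continuity of the integrand** (continuous `A`, `δ`, `e'`; Lipschitz shell weights vanishing near `s = 0` and at large `s`). -/
theorem klfb_continuous_integrand (hδc : Continuous δ) {A : ℝ × ℝ → ℂ} (hA : Continuous A) {f f' : ℝ → ℂ} {Lf Mf Lf' Mf' r₁ r₂ r₁' r₂' : ℝ}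
    (hlip : ∀ s s', ‖f s - f s'‖ ≤ Lf * |s - s'|) (hbd : ∀ s, ‖f s‖ ≤ Mf) (hin : ∀ s, s ≤ r₁ ^ 2 → f s = 0)
    (hout : ∀ s, r₂ ^ 2 ≤ s → f s = 0) (hr₁ : 0 < r₁) (hr₂ : 0 < r₂)
    (hlip' : ∀ s s', ‖f' s - f' s'‖ ≤ Lf' * |s - s'|) (hbd' : ∀ s, ‖f' s‖ ≤ Mf') (hin' : ∀ s, s ≤ r₁' ^ 2 → f' s = 0)
    (hout' : ∀ s, r₂' ^ 2 ≤ s → f' s = 0) (hr₁' : 0 < r₁') (hr₂' : 0 < r₂')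
    {e' : ℝ × ℝ → ℝ} (he' : Continuous e') (μ k₀ q₀ : ℝ) :
    Continuous (klfb_integrand δ μ A f f' e' k₀ q₀) := by
  unfold klfb_integrand
  exact (hA.mul ((klfb_continuous_prop_snd hlip hbd hin hout hr₁ hr₂ k₀).comp (klfb_continuous_band hδc μ))).mul
    ((klfb_continuous_prop_snd hlip' hbd' hin' hout' hr₁' hr₂' (k₀ + q₀)).comp he')

omit B in
/-- **Support of the integrand**: in the open square (from `A`) and in the tube `|e| < r` (from the first shell weight, `f(s) = 0` for `s ≥ r²`). -/
theorem klfb_integrand_support {A : ℝ × ℝ → ℂ} (hAsupp : ∀ p : ℝ × ℝ, A p ≠ 0 → |p.1| < π ∧ |p.2| < π) {f f' : ℝ → ℂ} {r : ℝ}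
    (hr : 0 ≤ r) (hout : ∀ s, r ^ 2 ≤ s → f s = 0) (e' : ℝ × ℝ → ℝ) (μ k₀ q₀ : ℝ) (p : ℝ × ℝ)
    (hp : klfb_integrand δ μ A f f' e' k₀ q₀ p ≠ 0) : |p.1| < π ∧ |p.2| < π ∧ |klfb_band δ μ p| < r := by
  unfold klfb_integrand at hp
  have hA : A p ≠ 0 := fun h => hp (by rw [h, zero_mul, zero_mul])
  have hΦ : klfb_prop f k₀ (klfb_band δ μ p) ≠ 0 := fun h => hp (by rw [h, mul_zero, zero_mul])
  exact ⟨(hAsupp p hA).1, (hAsupp p hA).2, klfb_abs_lt_of_prop_ne_zero hr hout hΦ⟩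

include B hδ1 hδ hκ hκ₁ in
/-- **The forward bubble on one ray, in level coordinates.**  With `ē = 4Λ_n`-type tube radius `r` (`f(s) = 0` for `s ≥ r²`) and the margin window,
`∫_{t>0} t • h(t cos θ, t sin θ) dt = ∫ W_θ(e)·Φ_f(k₀,e)·Φ_{f'}(k₀+q₀, e + σ_θ(e)) de` (integral over ℝ: the integrand vanishes for `|e| ≥ r`). -/
theorem klfb_ray_bubble_integral_eq {A : ℝ × ℝ → ℂ} (hA : Continuous A) (hAsupp : ∀ p : ℝ × ℝ, A p ≠ 0 → |p.1| < π ∧ |p.2| < π)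
    {f f' : ℝ → ℂ} {Lf Mf Lf' Mf' r₁ r r₁' r₂' : ℝ}
    (hlip : ∀ s s', ‖f s - f s'‖ ≤ Lf * |s - s'|) (hbd : ∀ s, ‖f s‖ ≤ Mf) (hin : ∀ s, s ≤ r₁ ^ 2 → f s = 0)
    (hout : ∀ s, r ^ 2 ≤ s → f s = 0) (hr₁ : 0 < r₁) (hr : 0 < r)
    (hlip' : ∀ s s', ‖f' s - f' s'‖ ≤ Lf' * |s - s'|) (hbd' : ∀ s, ‖f' s‖ ≤ Mf') (hin' : ∀ s, s ≤ r₁' ^ 2 → f' s = 0)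
    (hout' : ∀ s, r₂' ^ 2 ≤ s → f' s = 0) (hr₁' : 0 < r₁') (hr₂' : 0 < r₂')
    {e' : ℝ × ℝ → ℝ} (he' : Continuous e') {μ : ℝ} (hlo : a < μ - r - κ₀) (hhi : μ + r + κ₀ < b) (k₀ q₀ θ : ℝ) :
    ∫ t in Ioi (0 : ℝ), t • klfb_integrand δ μ A f f' e' k₀ q₀ (t * Real.cos θ, t * Real.sin θ) =
      ∫ e : ℝ, klfb_weight δ μ A θ e * klfb_prop f k₀ e * klfb_prop f' (k₀ + q₀) (e + klfb_shift δ μ e' θ e) := by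
  have hδc : Continuous δ := hδ1.continuous
  have hc := klfb_continuous_integrand hδc hA hlip hbd hin hout hr₁ hr hlip' hbd' hin' hout' hr₁' hr₂' he' μ k₀ q₀
  rw [klfb_ray_integral_eq B hδ1 hδ hκ hκ₁ hc hr.le hlo hhi (klfb_integrand_support hAsupp hr.le hout e' μ k₀ q₀) θ]
  -- the integrand on the window
  have hwin : ∀ e ∈ uIcc (-r) r, klfb_jac δ μ θ e • klfb_integrand δ μ A f f' e' k₀ q₀ (klfb_rayPt δ μ θ e) =
      klfb_weight δ μ A θ e * klfb_prop f k₀ e * klfb_prop f' (k₀ + q₀) (e + klfb_shift δ μ e' θ e) := by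
    intro e he
    rw [uIcc_of_le (by linarith)] at he
    have hlo' : a ≤ μ + e - κ₀ := by linarith [he.1]
    have hhi' : μ + e + κ₀ ≤ b := by linarith [he.2]
    unfold klfb_integrand klfb_weight klfb_shift
    rw [klfb_band_rayPt B hδ hδc hlo' hhi' θ, add_sub_cancel, Complex.real_smul]
    ring
  rw [intervalIntegral.integral_congr hwin]
  -- the integrand vanishes off the window
  refine intervalIntegral.integral_eq_integral_of_support_subset fun e he => ?_
  by_contra hnot
  apply he
  have hge : r ≤ |e| := by
    by_contra hlt
    push Not at hlt
    exact hnot ⟨by linarith [neg_abs_le e], (le_abs_self e).trans hlt.le⟩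
  simp only [klfb_prop_eq_zero_of_le_abs hr.le hout k₀ hge, mul_zero, zero_mul]

omit B in
/-- A radial Lipschitz constant is nonnegative. -/
theorem klfb_radialLip_nonneg {A : ℝ × ℝ → ℂ} {A₁ : ℝ}
    (hA1 : ∀ θ t t' : ℝ, 0 ≤ t → 0 ≤ t' →
      ‖A (t * Real.cos θ, t * Real.sin θ) - A (t' * Real.cos θ, t' * Real.sin θ)‖ ≤ A₁ * |t - t'|) : 0 ≤ A₁ := by
  have h := hA1 0 1 0 zero_le_one le_rfl
  have h0 : (0:ℝ) ≤ ‖A (1 * Real.cos 0, 1 * Real.sin 0) - A (0 * Real.cos 0, 0 * Real.sin 0)‖ := norm_nonneg _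
  have h1 : |(1:ℝ) - 0| = 1 := by norm_num
  rw [h1, mul_one] at h
  exact h0.trans h

include B hδ1 hδ hκ hκ₁ in
/-- **THE FORWARD SLICE BUBBLE ON ONE RAY (zero-sound remainder + thermal layer + transfer shift).**  Frame band `e = ε₀ + δ − μ` with p4's
hypotheses (`B : BandBounds a b`, `δ ∈ C¹`, `|δ| ≤ κ₀`, `‖Dδ‖ ≤ κ₁ < Dt_min` on the closed square, radial Lipschitz `κ₂` of `Dδ[dir θ]` along rays) and the
margin window `a < μ − 4Λ_n − κ₀`, `μ + 4Λ_n + κ₀ < b`; shell weights `f, f'` as in `klsw_slice_bubble_transfer_norm_le` (Lipschitz, bounded, supported in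
`(Λ_n/2)² < s < (4Λ_n)²`, product `F = f·f'` with `Lip F ≤ ℓ/Λ_n²`, `‖F‖ ≤ M_F`); planar weight `A` continuous, supported in the open square, `‖A‖ ≤ A₀`,
radially `A₁`-Lipschitz; shifted band `e'` continuous with `|e' − e| ≤ δ_max` on the open square; `β ≥ klBetaMin`, `n ≤ n_β + 1`,
`M ≥ β·4Λ_n/(2π) + 1`.  Then for every angle `θ`, with `d = Dt_min − κ₁`, `B_W = A₀·π√2/d`, `L_W = (π√2/d)·A₁/d + A₀·(1/d² + π√2(2+κ₂)/d³)`: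
`‖β⁻¹ • Σ_i ∫_{t>0} t • h_i(t cos θ, t sin θ) dt‖ ≤ (524288/π)(ℓ + 8M_F)·L_W·Λ_n + (393216/π)(ℓ + 8M_F)·B_W·(π/β)/Λ_n + (1024/π)M_f(48ℓ' + 193M_f')·B_W·(|q₀| + δ_max)/Λ_n`,
`h_i = klfb_integrand δ μ A f f' e' ω_i q₀`. -/
theorem klfb_ray_bubble_norm_le {A : ℝ × ℝ → ℂ} (hA : Continuous A) (hAsupp : ∀ p : ℝ × ℝ, A p ≠ 0 → |p.1| < π ∧ |p.2| < π)
    {A₀ A₁ : ℝ} (hA0 : ∀ p, ‖A p‖ ≤ A₀)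
    (hA1 : ∀ θ t t' : ℝ, 0 ≤ t → 0 ≤ t' →
      ‖A (t * Real.cos θ, t * Real.sin θ) - A (t' * Real.cos θ, t' * Real.sin θ)‖ ≤ A₁ * |t - t'|)
    {κ₂ : ℝ} (hκ₂ : 0 ≤ κ₂)
    (hD2 : ∀ θ s t : ℝ, s ∈ Icc 0 (π / ‖dir θ‖) → t ∈ Icc 0 (π / ‖dir θ‖) →
      |fderiv ℝ δ (s • dir θ) (dir θ) - fderiv ℝ δ (t • dir θ) (dir θ)| ≤ κ₂ * |s - t|)
    {f f' : ℝ → ℂ} {Lf Mf Lf' Mf' ℓ' LF MF ℓ : ℝ} {n : ℕ}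
    (hlip : ∀ s s', ‖f s - f s'‖ ≤ Lf * |s - s'|) (hbd : ∀ s, ‖f s‖ ≤ Mf)
    (hin : ∀ s, s ≤ (klScale klE0 n / 2) ^ 2 → f s = 0) (hout : ∀ s, (4 * klScale klE0 n) ^ 2 ≤ s → f s = 0)
    (hlip' : ∀ s s', ‖f' s - f' s'‖ ≤ Lf' * |s - s'|) (hbd' : ∀ s, ‖f' s‖ ≤ Mf') (hLf' : Lf' ≤ ℓ' / klScale klE0 n ^ 2)
    (hin' : ∀ s, s ≤ (klScale klE0 n / 2) ^ 2 → f' s = 0) (hout' : ∀ s, (4 * klScale klE0 n) ^ 2 ≤ s → f' s = 0)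
    (hMF : 0 ≤ MF) (hFlip : ∀ s s', ‖f s * f' s - f s' * f' s'‖ ≤ LF * |s - s'|) (hFbd : ∀ s, ‖f s * f' s‖ ≤ MF)
    (hLF : LF ≤ ℓ / klScale klE0 n ^ 2)
    {e' : ℝ × ℝ → ℝ} (he' : Continuous e') {μ δmax : ℝ} (hδ0 : 0 ≤ δmax)
    (he'δ : ∀ p : ℝ × ℝ, |p.1| < π → |p.2| < π → |e' p - klfb_band δ μ p| ≤ δmax)
    (hlo : a < μ - 4 * klScale klE0 n - κ₀) (hhi : μ + 4 * klScale klE0 n + κ₀ < b)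
    (q₀ : ℝ) {β : ℝ} (hβ : klBetaMin ≤ β) (hn : n ≤ nScales β + 1) {M : ℕ}
    (hM : β * (4 * klScale klE0 n) / (2 * Real.pi) + 1 ≤ M) (θ : ℝ) :
    ‖β⁻¹ • ∑ i : MatsubaraIdx M, ∫ t in Ioi (0 : ℝ),
        t • klfb_integrand δ μ A f f' e' (matsubaraFreq β M i) q₀ (t * Real.cos θ, t * Real.sin θ)‖ ≤
      524288 / Real.pi * (ℓ + 8 * MF) *
          (Real.pi * Real.sqrt 2 / (B.Dtmin - κ₁) * A₁ / (B.Dtmin - κ₁) +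
            A₀ * (1 / (B.Dtmin - κ₁) ^ 2 + Real.pi * Real.sqrt 2 * (2 + κ₂) / (B.Dtmin - κ₁) ^ 3)) * klScale klE0 n +
        393216 / Real.pi * (ℓ + 8 * MF) * (A₀ * (Real.pi * Real.sqrt 2 / (B.Dtmin - κ₁))) * ((Real.pi / β) / klScale klE0 n) +
          1024 / Real.pi * Mf * (48 * ℓ' + 193 * Mf') * (A₀ * (Real.pi * Real.sqrt 2 / (B.Dtmin - κ₁))) * (|q₀| + δmax) /
            klScale klE0 n := by
  have hδc : Continuous δ := hδ1.continuous
  have hΛ := klth_klScale_pos n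
  have hr₁ : 0 < klScale klE0 n / 2 := by positivity
  have hr : 0 < 4 * klScale klE0 n := by positivity
  have hd : 0 < B.Dtmin - κ₁ := by linarith
  have hA0' : 0 ≤ A₀ := (norm_nonneg _).trans (hA0 0)
  have hA1' : 0 ≤ A₁ := klfb_radialLip_nonneg hA1
  have hκ₀ : 0 ≤ κ₀ := (abs_nonneg _).trans (hδ 0 (fun i => by simp [Real.pi_pos.le]))
  have hμlo : a ≤ μ - κ₀ := by linarith
  have hμhi : μ + κ₀ ≤ b := by linarith
  -- per-ray identity, frequency by frequency
  have hray : ∀ i : MatsubaraIdx M, ∫ t in Ioi (0 : ℝ),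
      t • klfb_integrand δ μ A f f' e' (matsubaraFreq β M i) q₀ (t * Real.cos θ, t * Real.sin θ) =
        ∫ e : ℝ, klfb_weight δ μ A θ e * klfb_prop f (matsubaraFreq β M i) e *
          klfb_prop f' (matsubaraFreq β M i + q₀) (e + klfb_shift δ μ e' θ e) := fun i =>
    klfb_ray_bubble_integral_eq B hδ1 hδ hκ hκ₁ hA hAsupp hlip hbd hin hout hr₁ hr hlip' hbd' hin' hout' hr₁ hr he' hlo hhi _ q₀ θ
  rw [Finset.sum_congr rfl fun i _ => hray i]
  simp only [klfb_prop_apply]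
  -- window hypotheses of the insertion and the shift
  have hW : ContinuousOn (klfb_weight δ μ A θ) (Icc (-(4 * klScale klE0 n)) (4 * klScale klE0 n)) :=
    klfb_weight_continuousOn B hδ1 hδ hκ hκ₁ hA hlo hhi θ
  have hWlip : ∀ e : ℝ, |e| < 4 * klScale klE0 n → ‖klfb_weight δ μ A θ e - klfb_weight δ μ A θ 0‖ ≤
      (Real.pi * Real.sqrt 2 / (B.Dtmin - κ₁) * A₁ / (B.Dtmin - κ₁) +
          A₀ * (1 / (B.Dtmin - κ₁) ^ 2 + Real.pi * Real.sqrt 2 * (2 + κ₂) / (B.Dtmin - κ₁) ^ 3)) * |e| := by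
    intro e he
    have he' := abs_lt.mp he
    exact klfb_weight_sub_zero_norm_le B hδ1 hδ hκ hκ₁ hA0 hA1 hκ₂ (hD2 θ) hμlo hμhi (by linarith) (by linarith)
  have hWbd : ∀ e : ℝ, |e| < 4 * klScale klE0 n → ‖klfb_weight δ μ A θ e‖ ≤ A₀ * (Real.pi * Real.sqrt 2 / (B.Dtmin - κ₁)) := by
    intro e he
    have he' := abs_lt.mp he
    exact klfb_weight_norm_le B hδ hκ hκ₁ hδc hA0 (by linarith) (by linarith) θ
  have hσc : ContinuousOn (klfb_shift δ μ e' θ) (Icc (-(4 * klScale klE0 n)) (4 * klScale klE0 n)) :=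
    klfb_shift_continuousOn B hδ1 hδ hκ hκ₁ he' hlo hhi θ
  have hσ : ∀ e : ℝ, |e| ≤ 4 * klScale klE0 n → |klfb_shift δ μ e' θ e| ≤ δmax := by
    intro e he
    have he' := abs_le.mp he
    exact klfb_shift_abs_le B hδ hδc he'δ (by linarith) (by linarith) θ
  have hLW : 0 ≤ Real.pi * Real.sqrt 2 / (B.Dtmin - κ₁) * A₁ / (B.Dtmin - κ₁) +
      A₀ * (1 / (B.Dtmin - κ₁) ^ 2 + Real.pi * Real.sqrt 2 * (2 + κ₂) / (B.Dtmin - κ₁) ^ 3) := by positivity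
  have hBW : 0 ≤ A₀ * (Real.pi * Real.sqrt 2 / (B.Dtmin - κ₁)) := by positivity
  exact klsw_slice_bubble_transfer_norm_le hlip hbd hin hout hlip' hbd' hLf' hin' hout' hMF hFlip hFbd hLF hW hLW hBW hWlip hWbd hσc hδ0 hσ
    q₀ hβ hn hM

/-! ## §6 The planar bound (angle integration) -/

omit B in
/-- A planar weight supported in the open square has compact support. -/
theorem klfb_hasCompactSupport_of_square {A : ℝ × ℝ → ℂ} (hAsupp : ∀ p : ℝ × ℝ, A p ≠ 0 → |p.1| < π ∧ |p.2| < π) :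
    HasCompactSupport A := by
  refine HasCompactSupport.intro ((isCompact_Icc (a := -π) (b := π)).prod (isCompact_Icc (a := -π) (b := π))) fun p hp => ?_
  by_contra hne
  obtain ⟨h1, h2⟩ := hAsupp p hne
  exact hp ⟨⟨(abs_lt.mp h1).1.le, (abs_lt.mp h1).2.le⟩, ⟨(abs_lt.mp h2).1.le, (abs_lt.mp h2).2.le⟩⟩

include B hδ1 hδ hκ hκ₁ in
/-- **THE FORWARD SLICE BUBBLE OF THE FRAME BAND ON THE PLANE (continuum momentum, discrete Matsubara sum).**  Under the hypotheses of
`klfb_ray_bubble_norm_le`: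
`‖β⁻¹ • Σ_i ∫ d²p A(p)·Φ_f(ω_i, e(p))·Φ_{f'}(ω_i + q₀, e'(p))‖ ≤ 2π · [(524288/π)(ℓ + 8M_F)·L_W·Λ_n + (393216/π)(ℓ + 8M_F)·B_W·(π/β)/Λ_n + (1024/π)M_f(48ℓ' + 193M_f')·B_W·(|q₀| + δ_max)/Λ_n]`
— the zero-sound remainder (`C₀·4^{−n}` branch, `Λ_n = e₀4^{−n}`), the THERMAL LAYER (`(π/β)/Λ_n ≤ 4·4^{−(n_β−n)}`, `klte_ratio_le_four_mul_inv_pow`, the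
`thermalBar` profile) and the transfer shift (`K·ρ/Λ_n` branch) of the «below-resolution» particle–hole gain, for the frame band, in ONE citation
(coarea `klrf_*` + Jacobian `klrj_*` + per-ray `klsw_*` + angle integration `klry_*`). -/
theorem klfb_planar_bubble_norm_le {A : ℝ × ℝ → ℂ} (hA : Continuous A) (hAsupp : ∀ p : ℝ × ℝ, A p ≠ 0 → |p.1| < π ∧ |p.2| < π)
    {A₀ A₁ : ℝ} (hA0 : ∀ p, ‖A p‖ ≤ A₀)
    (hA1 : ∀ θ t t' : ℝ, 0 ≤ t → 0 ≤ t' →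
      ‖A (t * Real.cos θ, t * Real.sin θ) - A (t' * Real.cos θ, t' * Real.sin θ)‖ ≤ A₁ * |t - t'|)
    {κ₂ : ℝ} (hκ₂ : 0 ≤ κ₂)
    (hD2 : ∀ θ s t : ℝ, s ∈ Icc 0 (π / ‖dir θ‖) → t ∈ Icc 0 (π / ‖dir θ‖) →
      |fderiv ℝ δ (s • dir θ) (dir θ) - fderiv ℝ δ (t • dir θ) (dir θ)| ≤ κ₂ * |s - t|)
    {f f' : ℝ → ℂ} {Lf Mf Lf' Mf' ℓ' LF MF ℓ : ℝ} {n : ℕ}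
    (hlip : ∀ s s', ‖f s - f s'‖ ≤ Lf * |s - s'|) (hbd : ∀ s, ‖f s‖ ≤ Mf)
    (hin : ∀ s, s ≤ (klScale klE0 n / 2) ^ 2 → f s = 0) (hout : ∀ s, (4 * klScale klE0 n) ^ 2 ≤ s → f s = 0)
    (hlip' : ∀ s s', ‖f' s - f' s'‖ ≤ Lf' * |s - s'|) (hbd' : ∀ s, ‖f' s‖ ≤ Mf') (hLf' : Lf' ≤ ℓ' / klScale klE0 n ^ 2)
    (hin' : ∀ s, s ≤ (klScale klE0 n / 2) ^ 2 → f' s = 0) (hout' : ∀ s, (4 * klScale klE0 n) ^ 2 ≤ s → f' s = 0)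
    (hMF : 0 ≤ MF) (hFlip : ∀ s s', ‖f s * f' s - f s' * f' s'‖ ≤ LF * |s - s'|) (hFbd : ∀ s, ‖f s * f' s‖ ≤ MF)
    (hLF : LF ≤ ℓ / klScale klE0 n ^ 2)
    {e' : ℝ × ℝ → ℝ} (he' : Continuous e') {μ δmax : ℝ} (hδ0 : 0 ≤ δmax)
    (he'δ : ∀ p : ℝ × ℝ, |p.1| < π → |p.2| < π → |e' p - klfb_band δ μ p| ≤ δmax)
    (hlo : a < μ - 4 * klScale klE0 n - κ₀) (hhi : μ + 4 * klScale klE0 n + κ₀ < b)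
    (q₀ : ℝ) {β : ℝ} (hβ : klBetaMin ≤ β) (hn : n ≤ nScales β + 1) {M : ℕ}
    (hM : β * (4 * klScale klE0 n) / (2 * Real.pi) + 1 ≤ M) :
    ‖β⁻¹ • ∑ i : MatsubaraIdx M, ∫ p : ℝ × ℝ, klfb_integrand δ μ A f f' e' (matsubaraFreq β M i) q₀ p‖ ≤
      2 * Real.pi *
        (524288 / Real.pi * (ℓ + 8 * MF) *
            (Real.pi * Real.sqrt 2 / (B.Dtmin - κ₁) * A₁ / (B.Dtmin - κ₁) +
              A₀ * (1 / (B.Dtmin - κ₁) ^ 2 + Real.pi * Real.sqrt 2 * (2 + κ₂) / (B.Dtmin - κ₁) ^ 3)) * klScale klE0 n +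
          393216 / Real.pi * (ℓ + 8 * MF) * (A₀ * (Real.pi * Real.sqrt 2 / (B.Dtmin - κ₁))) * ((Real.pi / β) / klScale klE0 n) +
            1024 / Real.pi * Mf * (48 * ℓ' + 193 * Mf') * (A₀ * (Real.pi * Real.sqrt 2 / (B.Dtmin - κ₁))) * (|q₀| + δmax) /
              klScale klE0 n) := by
  have hδc : Continuous δ := hδ1.continuous
  have hΛ := klth_klScale_pos n
  have hr₁ : 0 < klScale klE0 n / 2 := by positivity
  have hr : 0 < 4 * klScale klE0 n := by positivity
  have hcs := klfb_hasCompactSupport_of_square hAsupp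
  have hint : ∀ i : MatsubaraIdx M, Integrable (klfb_integrand δ μ A f f' e' (matsubaraFreq β M i) q₀) := by
    intro i
    have hc := klfb_continuous_integrand hδc hA hlip hbd hin hout hr₁ hr hlip' hbd' hin' hout' hr₁ hr he' μ (matsubaraFreq β M i) q₀
    refine hc.integrable_of_hasCompactSupport ?_
    unfold klfb_integrand
    exact (hcs.mul_right).mul_right
  exact klry_norm_smul_sum_integral_le_of_ray_bound hint fun θ _ =>
    klfb_ray_bubble_norm_le B hδ1 hδ hκ hκ₁ hA hAsupp hA0 hA1 hκ₂ hD2 hlip hbd hin hout hlip' hbd' hLf' hin' hout' hMF hFlip hFbd hLF he'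
      hδ0 he'δ hlo hhi q₀ hβ hn hM θ

end Frame

/-! ## §7 The frame instance: `δ_K = frameShift K ∘ toLp` under `FrameOK` in the KL regime (`κ₀ = κ₁ = κ₂ = 4A`, `klrk_*`) -/

section FrameOK

variable {R : RenConsts} {U c β μ : ℝ} {K : TrigPolyC4v} {a b : ℝ} (B : BandBounds a b)

omit B in
/-- The planar band of the frame instance is the tree's frame level: `klfb_band δ_K μ p = frameLevel μ K (toLp (p.1, p.2))`. -/
theorem klfb_band_frameShift (μ : ℝ) (K : TrigPolyC4v) (p : ℝ × ℝ) :
    klfb_band (fun k : Fin 2 → ℝ => frameShift K (WithLp.toLp 2 k)) μ p = frameLevel μ K (WithLp.toLp 2 ![p.1, p.2]) := by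
  rw [klfb_band, frameLevel_toLp]

/-- **THE FORWARD SLICE BUBBLE OF AN ADMISSIBLE FRAME'S BAND (planar, `FrameOK` instance).**  For `FrameOK R U (nScales β) μ K` in the regime
`klBetaMin ≤ β ≤ e^{c/U²}` (`0 ≤ c`, `0 ≤ R.Gfr j`), with `A := 2·Gfr0·|U| + 2·Gfr1·U² + Gfr2·c/log 4`, `4A < Dt_min`, `d = Dt_min − 4A`, the margin window
`a < μ − 4Λ_n − 4A`, `μ + 4Λ_n + 4A < b`, and the remaining hypotheses of `klfb_planar_bubble_norm_le` (weights `f, f'`, planar weight `A`, shifted band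
`e'`, `β`, `n ≤ n_β + 1`, `M`): the planar bound holds with `κ₁ = κ₂ = 4A` — every frame datum enters through `d` only. -/
theorem klfb_planar_bubble_norm_le_of_frameOK (hR : ∀ j, 0 ≤ R.Gfr j) (hc : 0 ≤ c) (hβmin : klBetaMin ≤ β)
    (hβc : β ≤ Real.exp (c / U ^ 2)) (hK : FrameOK R U (nScales β) μ K)
    (hA : 4 * (2 * R.Gfr 0 * |U| + 2 * R.Gfr 1 * U ^ 2 + R.Gfr 2 * (c / Real.log 4)) < B.Dtmin)
    {Apl : ℝ × ℝ → ℂ} (hApl : Continuous Apl) (hAsupp : ∀ p : ℝ × ℝ, Apl p ≠ 0 → |p.1| < π ∧ |p.2| < π)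
    {A₀ A₁ : ℝ} (hA0 : ∀ p, ‖Apl p‖ ≤ A₀)
    (hA1 : ∀ θ t t' : ℝ, 0 ≤ t → 0 ≤ t' →
      ‖Apl (t * Real.cos θ, t * Real.sin θ) - Apl (t' * Real.cos θ, t' * Real.sin θ)‖ ≤ A₁ * |t - t'|)
    {f f' : ℝ → ℂ} {Lf Mf Lf' Mf' ℓ' LF MF ℓ : ℝ} {n : ℕ}
    (hlip : ∀ s s', ‖f s - f s'‖ ≤ Lf * |s - s'|) (hbd : ∀ s, ‖f s‖ ≤ Mf)
    (hin : ∀ s, s ≤ (klScale klE0 n / 2) ^ 2 → f s = 0) (hout : ∀ s, (4 * klScale klE0 n) ^ 2 ≤ s → f s = 0)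
    (hlip' : ∀ s s', ‖f' s - f' s'‖ ≤ Lf' * |s - s'|) (hbd' : ∀ s, ‖f' s‖ ≤ Mf') (hLf' : Lf' ≤ ℓ' / klScale klE0 n ^ 2)
    (hin' : ∀ s, s ≤ (klScale klE0 n / 2) ^ 2 → f' s = 0) (hout' : ∀ s, (4 * klScale klE0 n) ^ 2 ≤ s → f' s = 0)
    (hMF : 0 ≤ MF) (hFlip : ∀ s s', ‖f s * f' s - f s' * f' s'‖ ≤ LF * |s - s'|) (hFbd : ∀ s, ‖f s * f' s‖ ≤ MF)
    (hLF : LF ≤ ℓ / klScale klE0 n ^ 2)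
    {e' : ℝ × ℝ → ℝ} (he' : Continuous e') {δmax : ℝ} (hδ0 : 0 ≤ δmax)
    (he'δ : ∀ p : ℝ × ℝ, |p.1| < π → |p.2| < π →
      |e' p - klfb_band (fun k : Fin 2 → ℝ => frameShift K (WithLp.toLp 2 k)) μ p| ≤ δmax)
    (hlo : a < μ - 4 * klScale klE0 n - 4 * (2 * R.Gfr 0 * |U| + 2 * R.Gfr 1 * U ^ 2 + R.Gfr 2 * (c / Real.log 4)))
    (hhi : μ + 4 * klScale klE0 n + 4 * (2 * R.Gfr 0 * |U| + 2 * R.Gfr 1 * U ^ 2 + R.Gfr 2 * (c / Real.log 4)) < b)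
    (q₀ : ℝ) (hn : n ≤ nScales β + 1) {M : ℕ} (hM : β * (4 * klScale klE0 n) / (2 * Real.pi) + 1 ≤ M) :
    ‖β⁻¹ • ∑ i : MatsubaraIdx M, ∫ p : ℝ × ℝ,
        klfb_integrand (fun k : Fin 2 → ℝ => frameShift K (WithLp.toLp 2 k)) μ Apl f f' e' (matsubaraFreq β M i) q₀ p‖ ≤
      2 * Real.pi *
        (524288 / Real.pi * (ℓ + 8 * MF) *
            (Real.pi * Real.sqrt 2 / (B.Dtmin - 4 * (2 * R.Gfr 0 * |U| + 2 * R.Gfr 1 * U ^ 2 + R.Gfr 2 * (c / Real.log 4))) * A₁ /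
                (B.Dtmin - 4 * (2 * R.Gfr 0 * |U| + 2 * R.Gfr 1 * U ^ 2 + R.Gfr 2 * (c / Real.log 4))) +
              A₀ * (1 / (B.Dtmin - 4 * (2 * R.Gfr 0 * |U| + 2 * R.Gfr 1 * U ^ 2 + R.Gfr 2 * (c / Real.log 4))) ^ 2 +
                Real.pi * Real.sqrt 2 * (2 + 4 * (2 * R.Gfr 0 * |U| + 2 * R.Gfr 1 * U ^ 2 + R.Gfr 2 * (c / Real.log 4))) /
                  (B.Dtmin - 4 * (2 * R.Gfr 0 * |U| + 2 * R.Gfr 1 * U ^ 2 + R.Gfr 2 * (c / Real.log 4))) ^ 3)) * klScale klE0 n +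
          393216 / Real.pi * (ℓ + 8 * MF) *
              (A₀ * (Real.pi * Real.sqrt 2 / (B.Dtmin - 4 * (2 * R.Gfr 0 * |U| + 2 * R.Gfr 1 * U ^ 2 + R.Gfr 2 * (c / Real.log 4))))) *
            ((Real.pi / β) / klScale klE0 n) +
          1024 / Real.pi * Mf * (48 * ℓ' + 193 * Mf') *
              (A₀ * (Real.pi * Real.sqrt 2 / (B.Dtmin - 4 * (2 * R.Gfr 0 * |U| + 2 * R.Gfr 1 * U ^ 2 + R.Gfr 2 * (c / Real.log 4))))) *
            (|q₀| + δmax) / klScale klE0 n) := by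
  have hAb := klrk_frame_C2_bound hR hc hβmin hβc hK
  have hsm := frameShift_toLp_small hAb le_rfl
  have hA4 : 0 ≤ 4 * (2 * R.Gfr 0 * |U| + 2 * R.Gfr 1 * U ^ 2 + R.Gfr 2 * (c / Real.log 4)) := by
    have h0 : 0 ≤ 2 * R.Gfr 0 * |U| := by have := hR 0; positivity
    have h1 : 0 ≤ 2 * R.Gfr 1 * U ^ 2 := by have := hR 1; positivity
    have h2 : 0 ≤ R.Gfr 2 * (c / Real.log 4) := by
      have := hR 2; have : 0 < Real.log 4 := Real.log_pos (by norm_num); positivity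
    linarith
  exact klfb_planar_bubble_norm_le B (contDiff_frameShift_toLp K) (fun k _ => hsm.1 k) (fun k _ => hsm.2.1 k) hA hApl hAsupp hA0 hA1 hA4
    (fun θ s t _ _ => klrk_frameShift_radial_lipschitz hR hc hβmin hβc hK θ s t) hlip hbd hin hout hlip' hbd' hLf' hin' hout' hMF hFlip
    hFbd hLF he' hδ0 he'δ hlo hhi q₀ hβmin hn hM

end FrameOK


end Summit.HubbardSuperconductivity.HubbardSuperconductivity.Theorems.KLRegimeSplit

end
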